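import Mathlib.Analysis.Complex.OpenMapping
import Literature.Analysis.Complex.TwoConstantsDisc
import Literature.MathematicalPhysics.QuantumFieldTheory.Balaban1983to89.B13Sqrt27Accretive
import Literature.MathematicalPhysics.QuantumFieldTheory.Balaban1983to89.B13EntrywiseWalks

/-!
# `Balaban1983to89.B13RealSliceEntryLetters` — T. Bałaban, *Propagators for lattice gauge theories in a background field*, Commun. Math.
Phys. **99** (1985) 389–434 [Balaban1985BackgroundPropagators], Thm 3.4 p. 400 («can be extended to analytic functions … small perturbations
of the operators depending on U only»), Thm 3.10 (3.107)–(3.108) p. 416; *Renormalization group approach to lattice gauge field theories. II*,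
Commun. Math. Phys. **116** (1988) 1–22 [Balaban1988RG2Cluster], p. 15 («analytic functions on the spaces (1.13), (1.14) of [I] with
constants α′₀, α′₁ much bigger than α₀, α₁»), (2.7) p. 13; T. Ransford, *Potential Theory in the Complex Plane* (CUP 1995) Thm 4.3.7
[Ransford1995] (Nevanlinna's two-constants theorem): THE ENTRYWISE (3.108)-LETTERS OF NODE N10's JUNCTION ON THE COMPLEX CONFIGURATION
BALL FROM LETTERS ON THE REAL SLICE ONLY — two constants along one complex line through the real slice (radius `×r∕(1+r)`, rate
`×(1−λ(r))`, `λ(r) ≤ (4∕π)r`, constant `B^{1−λ}M_b^{λ}`); for INVERTED families `u ↦ A(u)⁻¹`, `u ↦ A(u)^{−1∕2}` the complex-ball letters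
(holomorphy + a rate-free bound) from entrywise holomorphy of the UN-inverted `A` and ONE accretivity margin (landed `B13Sqrt27Accretive`
by name); the margin from a real coercive reference plus small complex deviation; a `u`-holomorphic family of REAL matrices is constant
(open mapping) — so the real typing drives `u`-dependence only when used on the real slice; a toy inhabitant with genuine `u`-dependence.

statement-level complex analysis ([folklore] two constants, open mapping) over the tree's `TwoConstantsDisc`, Mathlib and landed
`B13Sqrt27Accretive` ∕ `B13EntrywiseWalks` theorems, with citation tags; kernel-checked; nothing here is a claim about the Yang–Mills
mass gap; nothing of Bałaban's operators is constructed or asserted; no node is discharged; count-neutral.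

PROVENANCE.  PORT (cell `pub-ymgap`, D-0062 Track A, node N10 = [B13], in-edge N06 → N10 trigger (t-cplx); seat `pub-ymgap-dag-n10-c` g5,
module 38) of cell `ym-nodeO-ideate`'s ROUTE-P2 companion 21 `pub/ym-nodeO-ideate/memos/ROUTE-P2-files/SketchRealSliceEntryLetters.lean`
(seat P2 g32, memo `ROUTE-P2.md` v3.40 §S58; sha256 b10323982a5dc0872df05fa790e96db3c0d436755ed5915beba9a194163ff6ea; farm rc 0, 0 warnings, std
axioms there), on P2's explicit GO-in-advance for a port with provenance (bus 2026-08-27T07:15:23Z «[NODEO-P2-G32-REAL-SLICE-AT-THE-SOCKET]»):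
declarations BYTE-IDENTICAL to the companion except (i) the namespace `YM.NodeO.P2.RealSliceEntryLetters` → this Literature namespace, (ii) this
header, (iii) docstrings ADDED to the two undocumented helpers `lam_nonneg` ∕ `lam_lt_one` and `[cite:]` locators appended to the docstrings
tagged `[folklore]` only (Literature lint; statements and proofs untouched).  §0 of the companion is ITS verbatim copy of companions 13 ∕ 16 ∕ 17
(`SketchRealSlice.lean` §1–§2, §5; `NodeORealSlice.lean` §6) — not in the tree before this file.  Tree siblings (no overlap): module 33
`B13WalksOfB9Factors` (the configuration-CONSTANT real knit whose conclusion shape §1's `rawEntryLetters_of_realOps` reads per real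
background), module 34 `B13EntryLetterAlgebra`, module 31 `B13EntrywiseWalks` (`RawEntryLetters`), module 32
`Summit….N10AtRecord11B13WalksBlockEntrywise` (the consumer `hEL`).  The companion's own module docstring follows verbatim between the rules.

────────────────────────────────────────────────────────────────────────────────────────────────────────────────
# ym-nodeO-ideate · LENS P2 «around Bałaban» — COMPANION 21 «REAL SLICE AT THE ENTRYWISE JUNCTION» (planner folder ∕ HOME memo; NOT a tree file)

ROUTE-P2 v3.40, census section S58, typed candidates T-58.1 – T-58.6 (generation g32).

**WHAT THIS FILE IS.**  Since 2026-08-27T05:50Z the N10 junction of record (cell pub-ymgap, seat dag-n10-c g4) consumes NODE A's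
object data in ENTRYWISE currency: module 32 `Summit….BalabanUVNodesN10AtRecord11B13WalksBlockEntrywise` (p503378) takes, per
(2.14)-term, the binder `hEL : RawEntryLetters (Δ₀ Z t) (locF Z t) rf.R ρΔ BΔ` — module 31 `B13EntrywiseWalks` :627 (= this memo's
companion 19): (3.108)-type decay `‖Δ₀(u)_{ij}‖ ≤ B e^{−ρ d₁(i,j)}` AND entrywise holomorphy on the COMPLEX `rf.R`-ball of the
configuration space `E₃` — and module 33 `B13WalksOfB9Factors.rawEntryLetters_G_of_ops310` (p504924 ✓ 06:25Z) produces that datum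
from N06's typing of [B9] Thm 3.10, BUT configuration-CONSTANT (`fun _ : E => (toMatrix' (𝔬.G U)).map (algebraMap ℝ ℂ)`), because
N06's `Ops310` is REAL-operator-valued.  dag-n10-c's census v5 (`N10-RESIDUAL-CENSUS-v5.md`, «LOCATED (currency)») records: «a
u-HOLOMORPHIC family of such real matrices is constant, so the complex-ball version of the knit (module 32's `hEL` with genuine
u-dependence) needs N06's letters for COMPLEX-linear operators (the analytically continued G(U′U) of [B9] Thm 3.4 ∕ [II] p. 15) … not
in the tree; this is the precise shape of the [II] p.15 in-edge», trigger (t-cplx) «one file `B13WalksOfB9FactorsHolo`».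
THIS FILE TYPES THE LENS-P2 ANSWER — S28's road (T) (two constants along one complex line through the real slice; companions 13 ∕ 16)
RE-ISSUED AT THE SOCKET OF RECORD, with the half it used to assume now discharged by tree theorems: the complex half of that in-edge
needs NO decay estimate at complex background (no «`Ops310` over ℂ with (3.108)», no Combes–Thomas conjugation of non-Hermitian operators).
* §0  VERBATIM COPY of `SketchRealSlice.lean` §1–§2, §5 (T-28.1 `norm_le_of_realSlice`, T-28.2 `decay_of_realSlice`, `RealStructure`,
  `lam`, the charts `realStructureComplex ∕ Pi`) and `NodeORealSlice.lean` §6 (`lam_eq`, `lam_le`: `λ(r) ≤ (4/π)r`) — self-contained.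
* §1  T-58.1 `rawEntryLetters_of_realSlice`: (L1ℝ) decay at the REAL configurations of the `R`-ball + (L3) entrywise holomorphy + (L0)
  a RATE-FREE bound `M_b` on the complex ball ⟹ `RawEntryLetters Δ₀ loc ((r∕(1+r))R) ((1−λ(r))ρ) (B^{1−λ}M_b^{λ})`, every `0 < r < 1`;
  T-58.1′ `rawEntryLetters_of_realOps`: the real-slice hypothesis READ OFF MODULE 33's conclusion shape — real matrices `G v` carrying
  the configuration-constant `RawEntryLetters` at each real `v` of the ball, and `Δ₀ v = (G v).map ofReal` there (the dictionary's
  identification, a HYPOTHESIS); T-58.6 `rawEntryLetters_of_realSlice_radii`: conclusion radius LITERALLY the consumer's `R₀` from inputs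
  on `R_an > 2R₀`, with `λ ≤ (4/π)·R₀∕(R_an − R₀)` (`lam_radii_le`) — the rate loss VANISHES in print's own regime «analytic functions on
  the spaces (1.13), (1.14) of [I] with constants α′₀, α′₁ much bigger than α₀, α₁» ([II] p.15).
* §2  T-58.2 `letters_inv_of_accretive` ∕ T-58.2′ `letters_invSqrt_of_accretive`: for INVERTED families `u ↦ A(u)⁻¹`, `u ↦ A(u)^{−1/2}`
  (the covariance-type operators and the `Γ = L·P^{−1/2}` slot of [II] (2.7)) the complex-ball letters (L3) + (L0) are TREE THEOREMS from
  entrywise holomorphy of the UN-inverted `A` + ONE accretivity margin `m > 0` (`B13Sqrt27Accretive.differentiableOn_inv_apply`,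
  `resolvent_bound_of_accretive` at `x = 0`: `‖(A(u)⁻¹)_{ij}‖ ≤ 2∕m`; `differentiableOn_invSqrt_apply`, `norm_invSqrt_apply_le_of_accretive`:
  `≤ 2∕√m`) — companions 13 ∕ 16 carried (L0) + (L3) as free letters.
* §3  T-58.3 `rawEntryLetters_inv_of_realSlice` (∕ T-58.3′ square-root slot): ASSEMBLED — (a) `A` entrywise holomorphic on the complex
  ball, (b) `m`-accretive there, (c) (3.108)-decay of `A(v)⁻¹` at the REAL `v` of the ball ⟹ `RawEntryLetters (u ↦ A(u)⁻¹)` on the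
  shrunken ball, constant `B^{1−λ}(max B (2∕m))^{λ}`.
* §4  T-58.4 `accretive_of_coercive_sub`: (b) from a REAL `γ`-coercive reference `T₀` (the operator at the real centre; [B9] Thm 3.12-shape
  positivity) + absolute row ∕ column sums `≤ p₀` of the complex deviation `A(u) − T₀` ([II] p.15 «perturbative argument»; tree
  `accretive_of_coercive_add` by name).
* §5  T-58.5 `eq_of_realValued` ∕ T-58.5′ `eq_of_realOps`: census v5's observation KERNEL-CHECKED — a complex-differentiable family of REAL
  matrices on a ball is constant (open mapping along the complex line through `0` and `u`; Mathlib `AnalyticOnNhd.is_constant_or_isOpen`):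
  the real typing cannot carry `u`-dependence at complex `u`; §1–§3 is the typing that can (real operators ON THE REAL SLICE ONLY).
* §6  NON-VACUITY WITH `u`-DEPENDENCE: the toy precision `A(u) = (γ+u)·1` over the chart `E = ℂ` meets (a)(b)(c) and T-58.3 fires
  (`rawEntryLetters_toy`) — no decay at complex `u` supplied; `toyFamily_diag_sub` shows the family moves with `u`.
SIBLINGS IN THE TREE (no overlap): module 34 `B13EntryLetterAlgebra` (p506135; sums ∕ products ∕ sandwiches of letters, u-constant local
factors) and module 33's Neumann-series inverse `one_sub_mul_inv_of_jointWalkExpansion` (smallness); §2 here is the function-theoretic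
complement (inverse letters from an accretivity MARGIN, no smallness; decay from the real slice).
NET LOCATED READING (memo S58, words): at the σ-free entrywise junction the OBJECT-level residual of the N06 → N10 complex in-edge is
«[B9] Thm 3.4 FIRST SENTENCE for the UN-inverted operators (the extension exists and is holomorphic — for `Δ′_a = Δ_U + Q′*aQ′` of
(3.24), polynomial in the bond variables `A(b)` ((3.50)–(3.53) p.400), immediate; for `Δ_a = Δ + DRD* + Q*aQ` of (3.26), whose `R(U)`
(3.25) contains `G′ = (Δ′_a)⁻¹` and `(Q′G′²Q′*)⁻¹`, by NESTED use of §2, one accretivity margin per inversion) + ONE accretivity margin per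
inverted operator on the complex ball (print, Thm 3.4 p.400: «describing these analytic extensions as small perturbations of the operators
depending on U only») + N06's REAL letters at EVERY real background of the ball + the chart's real structure (R-28.2)», priced by radius `×r∕(1+r)`, rate `×(1−λ(r))`, constant `B ↦ B^{1−λ}M_b^{λ}` — NOT «all the inequalities of Theorems
3.1–3.3 at complex background».  R-28.4's σ-objection is absent: the junction is σ-free, the transfer is in `u` only.
HONEST FRAMING: [folklore] function theory (Nevanlinna two constants; open mapping) over the tree's `TwoConstantsDisc` and Mathlib, and
APPLICATIONS of landed `B13Sqrt27Accretive` theorems; NOTHING of Bałaban's operators is constructed or asserted — NOT the real letters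
uniformly over his class of backgrounds (N06's schemas `Factors389` ∕ `Local342G` ∕ `Identities310` are inhabited for no operator of his in
the tree), NOT the accretivity margin of his `Δ_k(u)` ([B9] Thm 3.4 p.400-type), NOT which chart points are real (R-28.2), NOT that the
junction's `Δ₀` IS the inverse ∕ inverse root of a holomorphic accretive family in def-B13's dictionary ([B9] (3.24)–(3.27) pp.394–395:
`G′(U) = (Δ′_a)⁻¹`, `G(U) = (Δ_a|Ω₀)⁻¹` — print's shape, not typed here), NOT NODE O, NOT [B12] Thm 2, nothing continuum ∕ OS ∕ mass gap ∕
Clay.  `d` generic.  0 sorry.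

References: T. Ransford, *Potential Theory in the Complex Plane* (CUP 1995) Thm 4.3.7 [Ransford1995]; T. Bałaban, CMP 99 (1985)
389–434 [Balaban1985BackgroundPropagators] (3.24)–(3.27) pp.394–395, Thm 3.4 p.400, (3.50)–(3.53) p.400, Thm 3.10 (3.107)–(3.108)
pp.415–416, Thm 3.12 p.423; CMP 116 (1988) 1–22 [Balaban1988RG2Cluster] (2.5) p.12, (2.7) p.13, p.15, (2.16) p.16; CMP 109 (1987) 249–301 [Balaban1987RG1]
(1.13)–(1.14) p.262.
────────────────────────────────────────────────────────────────────────────────────────────────────────────────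
-/

noncomputable section

namespace Literature.MathematicalPhysics.QuantumFieldTheory.Balaban1983to89.B13RealSliceEntryLetters

open Metric Set Finset
open scoped Matrix
open Literature.Analysis.Complex.TwoConstantsDisc (norm_le_two_constants_disc_of_norm_le)
open Literature.MathematicalPhysics.QuantumFieldTheory.Balaban1983to89
open Literature.MathematicalPhysics.QuantumFieldTheory.Balaban1983to89.B9Thm37GlueTorus (tdist1 tdist1_nonneg tdist1_self)
open Literature.MathematicalPhysics.QuantumFieldTheory.Balaban1983to89.B5TorusCover (UT)
open Literature.MathematicalPhysics.QuantumFieldTheory.Balaban1983to89.B13EntrywiseWalks (RawEntryLetters)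
open Literature.MathematicalPhysics.QuantumFieldTheory.Balaban1983to89.B13Sqrt27Accretive
  (resolvent_bound_of_accretive differentiableOn_inv_apply invSqrt differentiableOn_invSqrt_apply
    norm_invSqrt_apply_le_of_accretive accretive_of_coercive_add)

variable {ν : ℕ} {Nf : Fin ν → ℕ} [∀ i, NeZero (Nf i)]
variable {E : Type*} [NormedAddCommGroup E] [NormedSpace ℂ E]
variable {p : Type} [Fintype p] [DecidableEq p]

/-! ## §0. VERBATIM COPY of `SketchRealSlice.lean` §1–§2, §5 and `NodeORealSlice.lean` §6 (memo companions are not lake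
modules; statements and proofs character-identical with companions 13 ∕ 16 ∕ 17) -/

/-- **A REAL STRUCTURE on the configuration space `E`** (named hypothesis shape): a set `Ereal` of «real»
configurations and maps `re`, `im : E → E` with `u = re u + i·im u`, every real line `x ↦ re u + x·im u` inside `Ereal`,
and `‖re u‖, ‖im u‖ ≤ ‖u‖`.  Inhabited by the coordinate charts `E = ℂ`, `E = ι → ℂ` (§0 end); meant: the anti-Hermitian ∕
Hermitian parts of `𝔤_ℂ`-valued bond variables.  Which configurations of Bałaban's `(𝐔, 𝐉)`-chart are «real» (the
Hermitian locus) is NOT decided here (memo R-28.2). [folklore] [cite: Ransford1995, Thm. 4.3.7; Balaban1988RG2Cluster, p.15] -/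
structure RealStructure (E : Type*) [NormedAddCommGroup E] [NormedSpace ℂ E] where
  Ereal : Set E
  re : E → E
  im : E → E
  decomp : ∀ u, re u + (Complex.I : ℂ) • im u = u
  line : ∀ u (x : ℝ), re u + (x : ℂ) • im u ∈ Ereal
  norm_re_le : ∀ u, ‖re u‖ ≤ ‖u‖
  norm_im_le : ∀ u, ‖im u‖ ≤ ‖u‖

/-- The two-constants exponent `λ(r) = (2/π)·arctan(2r∕(1−r²))` of the tree's `norm_le_two_constants_disc_of_norm_le`
(one minus the harmonic measure of the diameter seen from distance `r`); `λ(1/2) = (2/π)·arctan(4/3) ≈ 0.5903`.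
[cite: Ransford1995, Thm. 4.3.7] -/
def lam (r : ℝ) : ℝ := 2 / Real.pi * Real.arctan (2 * r / (1 - r ^ 2))

/-- The exponent is non-negative on `[0, 1)`. [cite: Ransford1995, Thm. 4.3.7] -/
theorem lam_nonneg {r : ℝ} (hr0 : 0 ≤ r) (hr1 : r < 1) : 0 ≤ lam r := by
  unfold lam
  have h1 : 0 ≤ 2 * r / (1 - r ^ 2) := div_nonneg (by linarith) (by nlinarith)
  have h2 : 0 ≤ Real.arctan (2 * r / (1 - r ^ 2)) := by
    rw [← Real.arctan_zero]; exact Real.arctan_strictMono.monotone h1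
  exact mul_nonneg (div_nonneg (by norm_num) Real.pi_pos.le) h2

/-- The exponent is `< 1` (the harmonic measure of the diameter is positive). [cite: Ransford1995, Thm. 4.3.7] -/
theorem lam_lt_one (r : ℝ) : lam r < 1 := by
  unfold lam
  have := Real.arctan_lt_pi_div_two (2 * r / (1 - r ^ 2))
  rw [div_mul_eq_mul_div, div_lt_one Real.pi_pos]
  linarith

/-- **T-28.1 — THE SLICE TRANSFER** (two-constants along the complex line `z ↦ re u + (z∕r)·im u`, read at `z = r·i`):
`f` holomorphic on the ball `‖u‖ < R` of a complex normed space with values in a complex normed space, `‖f‖ ≤ M` on the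
ball, `‖f‖ ≤ m` on the REAL configurations of the ball, `0 ≤ m ≤ M`, `0 < r < 1` ⟹ `‖f u‖ ≤ m^{1−λ(r)}·M^{λ(r)}` for
`‖u‖ < (r∕(1+r))·R`.  Dimension-free (one complex line per point; no iteration over coordinates).
[cite: Ransford1995, Thm. 4.3.7] -/
theorem norm_le_of_realSlice (ℛ : RealStructure E) {F : Type*} [NormedAddCommGroup F] [NormedSpace ℂ F]
    {f : E → F} {R M m r : ℝ} (hf : DifferentiableOn ℂ f (ball (0 : E) R))
    (hM : ∀ u ∈ ball (0 : E) R, ‖f u‖ ≤ M) (hm : ∀ v ∈ ℛ.Ereal, ‖v‖ < R → ‖f v‖ ≤ m)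
    (hm0 : 0 ≤ m) (hmM : m ≤ M) (hr0 : 0 < r) (hr1 : r < 1) :
    ∀ u ∈ ball (0 : E) (r / (1 + r) * R), ‖f u‖ ≤ m ^ (1 - lam r) * M ^ lam r := by
  intro u hu
  rw [mem_ball_zero_iff] at hu
  set γ : ℂ → E := fun z => ℛ.re u + (z / (r : ℂ)) • ℛ.im u with hγ
  have hRr : (1 + r⁻¹) * (r / (1 + r) * R) = R := by field_simp; ring
  have hu' : (1 + r⁻¹) * ‖u‖ < R := by
    calc (1 + r⁻¹) * ‖u‖ < (1 + r⁻¹) * (r / (1 + r) * R) := by gcongr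
      _ = R := hRr
  -- the closed unit disc is mapped into the ball of analyticity
  have hγR : ∀ z : ℂ, ‖z‖ ≤ 1 → γ z ∈ ball (0 : E) R := by
    intro z hz
    rw [mem_ball_zero_iff]
    calc ‖γ z‖ ≤ ‖ℛ.re u‖ + ‖(z / (r : ℂ)) • ℛ.im u‖ := norm_add_le _ _
      _ = ‖ℛ.re u‖ + ‖z‖ / r * ‖ℛ.im u‖ := by
          rw [norm_smul, norm_div, Complex.norm_real, Real.norm_eq_abs, abs_of_pos hr0]
      _ ≤ ‖u‖ + 1 / r * ‖u‖ :=
          add_le_add (ℛ.norm_re_le u) (mul_le_mul (by gcongr) (ℛ.norm_im_le u) (norm_nonneg _) (by positivity))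
      _ = (1 + r⁻¹) * ‖u‖ := by ring
      _ < R := hu'
  have hγd : Differentiable ℂ γ := fun z =>
    (differentiableAt_const _).add ((differentiableAt_id.div_const _).smul_const _)
  have hmaps : MapsTo γ (closedBall (0 : ℂ) 1) (ball (0 : E) R) := fun z hz =>
    hγR z (mem_closedBall_zero_iff.1 hz)
  have hfγ : DiffContOnCl ℂ (f ∘ γ) (ball (0 : ℂ) 1) := by
    apply DifferentiableOn.diffContOnCl
    rw [closure_ball (0 : ℂ) one_ne_zero]
    exact hf.comp hγd.differentiableOn hmaps
  have hM' : ∀ z : ℂ, ‖z‖ ≤ 1 → ‖(f ∘ γ) z‖ ≤ M := fun z hz => hM _ (hγR z hz)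
  have hm' : ∀ x : ℝ, |x| < 1 → ‖(f ∘ γ) x‖ ≤ m := fun x hx => by
    have hx1 : ‖(x : ℂ)‖ ≤ 1 := by rw [Complex.norm_real, Real.norm_eq_abs]; exact hx.le
    have hmem : γ x ∈ ℛ.Ereal := by
      show ℛ.re u + ((x : ℂ) / (r : ℂ)) • ℛ.im u ∈ ℛ.Ereal
      rw [← Complex.ofReal_div]
      exact ℛ.line u (x / r)
    exact hm _ hmem (mem_ball_zero_iff.1 (hγR x hx1))
  have hz0 : ‖(r : ℂ) * Complex.I‖ ≤ r := by
    rw [norm_mul, Complex.norm_real, Complex.norm_I, mul_one, Real.norm_eq_abs, abs_of_pos hr0]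
  have key := norm_le_two_constants_disc_of_norm_le hfγ hM' hm' hm0 hmM hr1 hz0
  have hγu : γ ((r : ℂ) * Complex.I) = u := by
    show ℛ.re u + ((r : ℂ) * Complex.I / (r : ℂ)) • ℛ.im u = u
    rw [mul_div_cancel_left₀ _ (Complex.ofReal_ne_zero.2 hr0.ne')]
    exact ℛ.decomp u
  rw [Function.comp_apply, hγu] at key
  simpa only [lam] using key

/-- **T-28.2 — DECAY LETTERS AT COMPLEX BACKGROUND FROM THE REAL SLICE**: a kernel family `K : E → Matrix p n ℂ`
with holomorphic entries on `‖u‖ < R`, a rate-free bound `‖K(u)_{ij}‖ ≤ M_b` there, and decay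
`‖K(v)_{ij}‖ ≤ B e^{−δ d(i,j)}` on the REAL configurations of the ball (`0 ≤ B ≤ M_b`, `δ ≥ 0`, `d ≥ 0`) satisfies
`‖K(u)_{ij}‖ ≤ B^{1−λ} M_b^{λ} e^{−(1−λ)δ d(i,j)}` for `‖u‖ < (r∕(1+r))R`, `λ = λ(r)`.  [cite: Ransford1995, Thm. 4.3.7;
Balaban1985BackgroundPropagators, Thm 3.4 p.400, (3.108) p.416] -/
theorem decay_of_realSlice (ℛ : RealStructure E) {p n : Type} {K : E → Matrix p n ℂ} {dist : p → n → ℝ}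
    {R B Mb δ r : ℝ} (hK : ∀ i j, DifferentiableOn ℂ (fun u => K u i j) (ball (0 : E) R))
    (hMb : ∀ u ∈ ball (0 : E) R, ∀ i j, ‖K u i j‖ ≤ Mb)
    (hB : ∀ v ∈ ℛ.Ereal, ‖v‖ < R → ∀ i j, ‖K v i j‖ ≤ B * Real.exp (-(δ * dist i j)))
    (hB0 : 0 ≤ B) (hBM : B ≤ Mb) (hδ : 0 ≤ δ) (hdist : ∀ i j, 0 ≤ dist i j) (hr0 : 0 < r) (hr1 : r < 1) :
    ∀ u ∈ ball (0 : E) (r / (1 + r) * R), ∀ i j,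
      ‖K u i j‖ ≤ B ^ (1 - lam r) * Mb ^ lam r * Real.exp (-((1 - lam r) * δ * dist i j)) := by
  intro u hu i j
  have hm0 : 0 ≤ B * Real.exp (-(δ * dist i j)) := mul_nonneg hB0 (Real.exp_nonneg _)
  have hexp1 : Real.exp (-(δ * dist i j)) ≤ 1 :=
    Real.exp_le_one_iff.2 (neg_nonpos.2 (mul_nonneg hδ (hdist i j)))
  have hmM : B * Real.exp (-(δ * dist i j)) ≤ Mb := (mul_le_of_le_one_right hB0 hexp1).trans hBM
  have key := norm_le_of_realSlice ℛ (hK i j) (fun u hu => hMb u hu i j) (fun v hv hvR => hB v hv hvR i j)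
    hm0 hmM hr0 hr1 u hu
  have hrew : (B * Real.exp (-(δ * dist i j))) ^ (1 - lam r) * Mb ^ lam r
      = B ^ (1 - lam r) * Mb ^ lam r * Real.exp (-((1 - lam r) * δ * dist i j)) := by
    rw [Real.mul_rpow hB0 (Real.exp_nonneg _), ← Real.exp_mul]
    have : -(δ * dist i j) * (1 - lam r) = -((1 - lam r) * δ * dist i j) := by ring
    rw [this]; ring
  exact key.trans_eq hrew

/-- The real structure of `ℂ`: real axis, `re`, `im`. [folklore] [cite: Ransford1995, Thm. 4.3.7] -/
def realStructureComplex : RealStructure ℂ where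
  Ereal := Set.range ((↑) : ℝ → ℂ)
  re u := (u.re : ℂ)
  im u := (u.im : ℂ)
  decomp u := by rw [smul_eq_mul, mul_comm]; exact Complex.re_add_im u
  line u x := ⟨u.re + x * u.im, by push_cast; rw [smul_eq_mul]⟩
  norm_re_le u := by rw [Complex.norm_real, Real.norm_eq_abs]; exact Complex.abs_re_le_norm u
  norm_im_le u := by rw [Complex.norm_real, Real.norm_eq_abs]; exact Complex.abs_im_le_norm u

/-- The real structure of the coordinate chart `ι → ℂ` (sup norm): coordinatewise real and imaginary parts, real
configurations = coordinatewise real vectors. [folklore] [cite: Ransford1995, Thm. 4.3.7] -/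
def realStructurePi (ι : Type*) [Fintype ι] : RealStructure (ι → ℂ) where
  Ereal := {v | ∀ k, (v k).im = 0}
  re u := fun k => ((u k).re : ℂ)
  im u := fun k => ((u k).im : ℂ)
  decomp u := by
    funext k
    simp only [Pi.add_apply, Pi.smul_apply, smul_eq_mul]
    rw [mul_comm]; exact Complex.re_add_im (u k)
  line u x := by
    intro k
    simp
  norm_re_le u := (pi_norm_le_iff_of_nonneg (norm_nonneg u)).2 fun k => by
    rw [Complex.norm_real, Real.norm_eq_abs]
    exact (Complex.abs_re_le_norm (u k)).trans (norm_le_pi_norm u k)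
  norm_im_le u := (pi_norm_le_iff_of_nonneg (norm_nonneg u)).2 fun k => by
    rw [Complex.norm_real, Real.norm_eq_abs]
    exact (Complex.abs_im_le_norm (u k)).trans (norm_le_pi_norm u k)

/-- **T-28.6 — closed form of the exponent**: `λ(r) = (4/π)·arctan r` for `−1 < r < 1`. [cite: Ransford1995, Thm. 4.3.7] -/
theorem lam_eq {r : ℝ} (hr : -1 < r) (hr1 : r < 1) : lam r = 4 / Real.pi * Real.arctan r := by
  unfold lam
  rw [← Real.two_mul_arctan hr hr1]
  ring

/-- The rate loss is at most linear in the shrink parameter: `λ(r) ≤ (4/π)·r` for `0 ≤ r < 1`. [cite: Ransford1995, Thm. 4.3.7] -/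
theorem lam_le {r : ℝ} (hr0 : 0 ≤ r) (hr1 : r < 1) : lam r ≤ 4 / Real.pi * r := by
  rw [lam_eq (by linarith) hr1]
  have h := Real.le_tan (Real.arctan_nonneg.2 hr0) (Real.arctan_lt_pi_div_two r)
  rw [Real.tan_arctan] at h
  exact mul_le_mul_of_nonneg_left h (div_nonneg (by norm_num) Real.pi_pos.le)

/-! `§0 END` -/

/-! ## §1. T-58.1 — the slice transfer AT THE ENTRYWISE SOCKET `RawEntryLetters` (modules 31 ∕ 32 ∕ 33) -/

omit [Fintype p] [DecidableEq p] in
/-- The shrunken ball lies in the ball (for `R ≥ 0`), and both are empty for `R < 0`: holomorphy restricts.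
[folklore] [cite: Ransford1995, Thm. 4.3.7] -/
theorem differentiableOn_shrink {f : E → ℂ} {R r : ℝ} (hf : DifferentiableOn ℂ f (ball (0 : E) R))
    (hr0 : 0 < r) : DifferentiableOn ℂ f (ball (0 : E) (r / (1 + r) * R)) := by
  by_cases hR : 0 ≤ R
  · refine hf.mono (ball_subset_ball ?_)
    have h1 : r / (1 + r) ≤ 1 := (div_le_one (by linarith)).2 (by linarith)
    calc r / (1 + r) * R ≤ 1 * R := mul_le_mul_of_nonneg_right h1 hR
      _ = R := one_mul R
  · have hneg : r / (1 + r) * R < 0 := mul_neg_of_pos_of_neg (div_pos hr0 (by linarith)) (lt_of_not_ge hR)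
    rw [Metric.ball_eq_empty.2 hneg.le]
    exact differentiableOn_empty

omit [Fintype p] [DecidableEq p] in
/-- **T-58.1 — REAL-SLICE DECAY ⟹ THE ENTRYWISE LETTERS OF THE N10 JUNCTION ON THE SHRUNKEN COMPLEX BALL.**  A family
`Δ₀ : E → Matrix p p ℂ` with (L3) entrywise holomorphy on the complex ball `‖u‖ < R`, (L0) a RATE-FREE bound `‖Δ₀(u)_{ij}‖ ≤ M_b`
there, and (L1ℝ) the (3.108)-type decay `‖Δ₀(v)_{ij}‖ ≤ B e^{−ρ d₁(loc i, loc j)}` at the REAL configurations `v` of the ball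
only, `0 ≤ B ≤ M_b`, `ρ ≥ 0`, is a `RawEntryLetters` datum (module 31 `B13EntrywiseWalks` :627 — the binder `hEL` of module 32
`Summit….N10AtRecord11B13WalksBlockEntrywise`) on the ball `‖u‖ < (r∕(1+r))R` with rate `(1−λ(r))ρ` and constant
`B^{1−λ(r)} M_b^{λ(r)}`, for every `0 < r < 1`.  [cite: Ransford1995, Thm. 4.3.7; Balaban1985BackgroundPropagators, Thm 3.4
p.400, Thm 3.10 (3.107)–(3.108) p.416; Balaban1988RG2Cluster, p.15] -/
theorem rawEntryLetters_of_realSlice (ℛ : RealStructure E) {Δ₀ : E → Matrix p p ℂ} {loc : p → UT Nf}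
    {R ρ B Mb r : ℝ} (hholo : ∀ i j, DifferentiableOn ℂ (fun u => Δ₀ u i j) (ball (0 : E) R))
    (hMb : ∀ u ∈ ball (0 : E) R, ∀ i j, ‖Δ₀ u i j‖ ≤ Mb)
    (hreal : ∀ v ∈ ℛ.Ereal, ‖v‖ < R → ∀ i j, ‖Δ₀ v i j‖ ≤ B * Real.exp (-(ρ * tdist1 Nf (loc i) (loc j))))
    (hB0 : 0 ≤ B) (hBM : B ≤ Mb) (hρ : 0 ≤ ρ) (hr0 : 0 < r) (hr1 : r < 1) :
    RawEntryLetters Δ₀ loc (r / (1 + r) * R) ((1 - lam r) * ρ) (B ^ (1 - lam r) * Mb ^ lam r) where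
  decay u hu i j :=
    decay_of_realSlice ℛ (dist := fun i j => tdist1 Nf (loc i) (loc j)) hholo hMb hreal hB0 hBM hρ
      (fun _ _ => tdist1_nonneg _ _) hr0 hr1 u hu i j
  holo i j := differentiableOn_shrink (hholo i j) hr0
  B_nonneg := mul_nonneg (Real.rpow_nonneg hB0 _) (Real.rpow_nonneg (hB0.trans hBM) _)

omit [Fintype p] [DecidableEq p] in
/-- **T-58.1′ — THE JUNCTION EDITION, BY SHAPE WITH MODULE 33.**  N06's typing of [B9] Thm 3.10 is REAL-operator-valued
(`B9Theorem310Skeleton.Ops310.G U : Module.End ℝ (X → ℝ)`), and module 33 `B13WalksOfB9Factors.rawEntryLetters_G_of_ops310`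
delivers, AT ONE BACKGROUND, the configuration-CONSTANT datum `RawEntryLetters (fun _ : E => (toMatrix' (𝔬.G U)).map (algebraMap ℝ ℂ))
𝔬.blk R′ κ B₃₃` on every ball.  A `u`-holomorphic family of REAL matrices is constant (T-58.5′ below), so genuine `u`-dependence
cannot be typed through `Ops310`; it need not be: if the COMPLEX family `Δ₀ : E → Matrix p p ℂ` agrees ON THE REAL SLICE of the
ball with real matrices `G v` each carrying module 33's constant-family letters (rate `ρ`, constant `B`, any radius `R′ > 0`), and
`Δ₀` has (L3) + (L0) on the complex ball, then `Δ₀` itself is a `RawEntryLetters` datum on the shrunken ball — T-58.1 with the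
real-slice hypothesis read off module 33's conclusion shape per real background.  The identification `Δ₀ v = (G v).map ofReal` for
real `v` (which chart points are unitary backgrounds, and that `Δ₀` there IS N06's `G`) is the dictionary's (def-B13) statement,
a hypothesis here. [cite: Balaban1985BackgroundPropagators, Thm 3.4 p.400, Thm 3.10 (3.108) p.416; Balaban1988RG2Cluster, p.15] -/
theorem rawEntryLetters_of_realOps (ℛ : RealStructure E) {Δ₀ : E → Matrix p p ℂ} (G : E → Matrix p p ℝ)
    {loc : p → UT Nf} {R R' ρ B Mb r : ℝ} (hR' : 0 < R')
    (hslice : ∀ v ∈ ℛ.Ereal, ‖v‖ < R → Δ₀ v = (G v).map (algebraMap ℝ ℂ))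
    (hreal : ∀ v ∈ ℛ.Ereal, ‖v‖ < R →
      RawEntryLetters (fun _ : E => (G v).map (algebraMap ℝ ℂ)) loc R' ρ B)
    (hholo : ∀ i j, DifferentiableOn ℂ (fun u => Δ₀ u i j) (ball (0 : E) R))
    (hMb : ∀ u ∈ ball (0 : E) R, ∀ i j, ‖Δ₀ u i j‖ ≤ Mb)
    (hB0 : 0 ≤ B) (hBM : B ≤ Mb) (hρ : 0 ≤ ρ) (hr0 : 0 < r) (hr1 : r < 1) :
    RawEntryLetters Δ₀ loc (r / (1 + r) * R) ((1 - lam r) * ρ) (B ^ (1 - lam r) * Mb ^ lam r) :=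
  rawEntryLetters_of_realSlice ℛ hholo hMb (fun v hv hvR i j => by
    rw [hslice v hv hvR]
    exact (hreal v hv hvR).decay 0 (mem_ball_self hR') i j) hB0 hBM hρ hr0 hr1

omit [Fintype p] [DecidableEq p] in
/-- **T-58.6 — RADII EDITION (the consumer's radius LITERALLY; the price in print's regime).**  For a target radius `R₀ > 0` (the
junction's `rf.R` in module 32's `hEL`) and an input radius `R_an > 2R₀` (the analyticity radius: [II] p.15 «analytic functions on the
spaces (1.13), (1.14) [I] with constants α′₀, α′₁ MUCH BIGGER than α₀, α₁»), real-slice decay + (L3) + (L0) on the `R_an`-ball give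
`RawEntryLetters Δ₀ loc R₀` with rate `(1 − λ(r))ρ`, `r = R₀∕(R_an − R₀)`; by T-28.6 `λ(r) ≤ (4/π)·R₀∕(R_an − R₀)` — the rate loss
VANISHES in the limit `R₀∕R_an → 0` that print's «much bigger» already grants.  [cite: Ransford1995, Thm. 4.3.7; Balaban1988RG2Cluster,
p.15; Balaban1987RG1, (1.13)–(1.14) p.262] -/
theorem rawEntryLetters_of_realSlice_radii (ℛ : RealStructure E) {Δ₀ : E → Matrix p p ℂ} {loc : p → UT Nf}
    {Ran R₀ ρ B Mb : ℝ} (hR₀ : 0 < R₀) (h2 : 2 * R₀ < Ran)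
    (hholo : ∀ i j, DifferentiableOn ℂ (fun u => Δ₀ u i j) (ball (0 : E) Ran))
    (hMb : ∀ u ∈ ball (0 : E) Ran, ∀ i j, ‖Δ₀ u i j‖ ≤ Mb)
    (hreal : ∀ v ∈ ℛ.Ereal, ‖v‖ < Ran → ∀ i j, ‖Δ₀ v i j‖ ≤ B * Real.exp (-(ρ * tdist1 Nf (loc i) (loc j))))
    (hB0 : 0 ≤ B) (hBM : B ≤ Mb) (hρ : 0 ≤ ρ) :
    RawEntryLetters Δ₀ loc R₀ ((1 - lam (R₀ / (Ran - R₀))) * ρ)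
      (B ^ (1 - lam (R₀ / (Ran - R₀))) * Mb ^ lam (R₀ / (Ran - R₀))) := by
  have hd : 0 < Ran - R₀ := by linarith
  have hd' : Ran - R₀ ≠ 0 := hd.ne'
  have hr0 : 0 < R₀ / (Ran - R₀) := div_pos hR₀ hd
  have hr1 : R₀ / (Ran - R₀) < 1 := (div_lt_one hd).2 (by linarith)
  have h := rawEntryLetters_of_realSlice ℛ hholo hMb hreal hB0 hBM hρ hr0 hr1
  have e : R₀ / (Ran - R₀) / (1 + R₀ / (Ran - R₀)) * Ran = R₀ := by
    field_simp
    ring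
  rwa [e] at h

/-- The rate loss of the radii edition: `λ(R₀∕(R_an − R₀)) ≤ (4/π)·R₀∕(R_an − R₀)` (`→ 0` as `R₀∕R_an → 0`). [cite: Ransford1995, Thm. 4.3.7] -/
theorem lam_radii_le {Ran R₀ : ℝ} (hR₀ : 0 ≤ R₀) (h2 : 2 * R₀ < Ran) :
    lam (R₀ / (Ran - R₀)) ≤ 4 / Real.pi * (R₀ / (Ran - R₀)) := by
  have hd : 0 < Ran - R₀ := by linarith
  exact lam_le (div_nonneg hR₀ hd.le) ((div_lt_one hd).2 (by linarith))

/-! ## §2. T-58.2 — letters (L0) + (L3) on the COMPLEX ball for INVERTED families, from accretivity (tree theorems by name) -/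

/-- **T-58.2 — THE INVERSE OF A HOLOMORPHIC UNIFORMLY ACCRETIVE FAMILY HAS HOLOMORPHIC, RATE-FREE-BOUNDED ENTRIES.**  If
`u ↦ A(u)` is entrywise complex-differentiable on a set `s` of configurations and every `A(u)`, `u ∈ s`, is `m`-accretive with ONE
`m > 0` (`m Σ|v_i|² ≤ Re Σ v̄_i (A(u)v)_i`), then every `A(u)` is invertible, `u ↦ (A(u)⁻¹)_{ij}` is complex-differentiable on `s`
(Cramer; tree `B13Sqrt27Accretive.differentiableOn_inv_apply`) and `‖(A(u)⁻¹)_{ij}‖ ≤ 2∕m` (tree `resolvent_bound_of_accretive` at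
spectral parameter `x = 0`) — letters (L3) and (L0) of T-58.1 for the inverse family, with NO locality, NO symmetry and NO decay
input at complex background: [B9] Thm 3.4's FIRST sentence («can be extended to analytic functions») plus an accretivity margin.
[cite: Balaban1985BackgroundPropagators, Thm 3.4 p.400; Balaban1988RG2Cluster, (2.7) p.13, p.15] -/
theorem letters_inv_of_accretive {A : E → Matrix p p ℂ} {s : Set E} {m : ℝ} (hm : 0 < m)
    (hA : ∀ i j, DifferentiableOn ℂ (fun u => A u i j) s)
    (hacc : ∀ u ∈ s, ∀ v : p → ℂ, m * ∑ i, ‖v i‖ ^ 2 ≤ (∑ i, star (v i) * (A u *ᵥ v) i).re) :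
    (∀ i j, DifferentiableOn ℂ (fun u => (A u)⁻¹ i j) s) ∧ ∀ u ∈ s, ∀ i j, ‖(A u)⁻¹ i j‖ ≤ 2 / m := by
  have key : ∀ u ∈ s, IsUnit (A u).det ∧ ∀ i j, ‖(A u)⁻¹ i j‖ ≤ 2 / m := by
    intro u hu
    have h := resolvent_bound_of_accretive (A u) hm (hacc u hu) (le_refl (0 : ℝ))
    have e : ((0 : ℝ) : ℂ) • (1 : Matrix p p ℂ) + A u = A u := by
      rw [Complex.ofReal_zero, zero_smul, zero_add]
    rw [e, add_zero] at h
    exact h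
  exact ⟨fun i j => differentiableOn_inv_apply hA (fun u hu => (key u hu).1) i j, fun u hu => (key u hu).2⟩

/-- **T-58.2′ — THE SAME FOR THE SQUARE-ROOT SLOT (2.7)**: `u ↦ (A(u)^{−1/2})_{ij}` (the resolvent-integral `invSqrt` of the
tree) is complex-differentiable on the ball and `‖(A(u)^{−1/2})_{ij}‖ ≤ 2∕√m` — tree `differentiableOn_invSqrt_apply`,
`norm_invSqrt_apply_le_of_accretive` by name (the `Γ = L·P^{−1/2}` factor of [II] (2.7) at complex background).
[cite: Balaban1988RG2Cluster, (2.7) p.13, p.15] -/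
theorem letters_invSqrt_of_accretive {A : E → Matrix p p ℂ} {R m : ℝ} (hm : 0 < m)
    (hA : ∀ i j, DifferentiableOn ℂ (fun u => A u i j) (ball (0 : E) R))
    (hacc : ∀ u ∈ ball (0 : E) R, ∀ v : p → ℂ, m * ∑ i, ‖v i‖ ^ 2 ≤ (∑ i, star (v i) * (A u *ᵥ v) i).re) :
    (∀ i j, DifferentiableOn ℂ (fun u => invSqrt (A u) i j) (ball (0 : E) R)) ∧
      ∀ u ∈ ball (0 : E) R, ∀ i j, ‖invSqrt (A u) i j‖ ≤ 2 / Real.sqrt m :=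
  ⟨fun i j => differentiableOn_invSqrt_apply A hm hacc hA i j,
    fun u hu i j => norm_invSqrt_apply_le_of_accretive (A u) hm (hacc u hu) i j⟩

/-! ## §3. T-58.3 — ASSEMBLED: real-slice decay of the inverse + holomorphy and accretivity of the UN-inverted family
⟹ the junction's letters for the inverse family on the shrunken complex ball -/

/-- **T-58.3 — COMPLEX-BACKGROUND ENTRYWISE LETTERS OF A COVARIANCE-TYPE FAMILY `u ↦ A(u)⁻¹` FROM THREE `u`-ONLY INPUTS**:
(a) `A` entrywise holomorphic on the complex ball `‖u‖ < R` (for Bałaban's `Δ′_a = Δ_U + Q′*aQ′` of [B9] (3.24) — polynomial in the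
bond variables, (3.50)–(3.53) — immediate; for `Δ_a` of (3.26), whose `R(U)` (3.25) contains inverses, by nested use of T-58.2); (b) ONE
accretivity margin `m > 0` for `A(u)` on the ball ([B9] Thm 3.4 p.400 «small perturbations of the operators depending on U only» ∕ [II]
p.15's «perturbative argument»; T-58.4 supplies it from REAL coercivity at the centre + smallness of the complex deviation); (c) (3.108)-type decay of `A(v)⁻¹` at the REAL configurations `v` of the ball ([B9] Thm 3.10 — print's proved
case; module 33 per background) ⟹ `RawEntryLetters (u ↦ A(u)⁻¹)` on `‖u‖ < (r∕(1+r))R` with rate `(1−λ(r))ρ` and constant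
`B^{1−λ} (max B (2∕m))^{λ}`.  NO Combes–Thomas ∕ conjugation argument at complex background is used.
[cite: Ransford1995, Thm. 4.3.7; Balaban1985BackgroundPropagators, (3.24)–(3.27) pp.394–395, Thm 3.4 p.400, Thm 3.10 (3.108) p.416;
Balaban1988RG2Cluster, (2.7) p.13, p.15] -/
theorem rawEntryLetters_inv_of_realSlice (ℛ : RealStructure E) {A : E → Matrix p p ℂ} {loc : p → UT Nf}
    {R m ρ B r : ℝ} (hm : 0 < m)
    (hA : ∀ i j, DifferentiableOn ℂ (fun u => A u i j) (ball (0 : E) R))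
    (hacc : ∀ u ∈ ball (0 : E) R, ∀ v : p → ℂ, m * ∑ i, ‖v i‖ ^ 2 ≤ (∑ i, star (v i) * (A u *ᵥ v) i).re)
    (hreal : ∀ v ∈ ℛ.Ereal, ‖v‖ < R → ∀ i j,
      ‖(A v)⁻¹ i j‖ ≤ B * Real.exp (-(ρ * tdist1 Nf (loc i) (loc j))))
    (hB0 : 0 ≤ B) (hρ : 0 ≤ ρ) (hr0 : 0 < r) (hr1 : r < 1) :
    RawEntryLetters (fun u => (A u)⁻¹) loc (r / (1 + r) * R) ((1 - lam r) * ρ)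
      (B ^ (1 - lam r) * (max B (2 / m)) ^ lam r) := by
  obtain ⟨hholo, hbd⟩ := letters_inv_of_accretive hm hA hacc
  exact rawEntryLetters_of_realSlice ℛ hholo (fun u hu i j => (hbd u hu i j).trans (le_max_right _ _)) hreal hB0
    (le_max_left _ _) hρ hr0 hr1

/-- **T-58.3′ — the square-root slot**: the same for `u ↦ A(u)^{−1/2}` (`invSqrt`), constant `B^{1−λ} (max B (2∕√m))^{λ}`.
[cite: Ransford1995, Thm. 4.3.7; Balaban1988RG2Cluster, (2.7) p.13, p.15; Balaban1985BackgroundPropagators, Thm 3.10 (3.108) p.416] -/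
theorem rawEntryLetters_invSqrt_of_realSlice (ℛ : RealStructure E) {A : E → Matrix p p ℂ} {loc : p → UT Nf}
    {R m ρ B r : ℝ} (hm : 0 < m)
    (hA : ∀ i j, DifferentiableOn ℂ (fun u => A u i j) (ball (0 : E) R))
    (hacc : ∀ u ∈ ball (0 : E) R, ∀ v : p → ℂ, m * ∑ i, ‖v i‖ ^ 2 ≤ (∑ i, star (v i) * (A u *ᵥ v) i).re)
    (hreal : ∀ v ∈ ℛ.Ereal, ‖v‖ < R → ∀ i j,
      ‖invSqrt (A v) i j‖ ≤ B * Real.exp (-(ρ * tdist1 Nf (loc i) (loc j))))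
    (hB0 : 0 ≤ B) (hρ : 0 ≤ ρ) (hr0 : 0 < r) (hr1 : r < 1) :
    RawEntryLetters (fun u => invSqrt (A u)) loc (r / (1 + r) * R) ((1 - lam r) * ρ)
      (B ^ (1 - lam r) * (max B (2 / Real.sqrt m)) ^ lam r) := by
  obtain ⟨hholo, hbd⟩ := letters_invSqrt_of_accretive hm hA hacc
  exact rawEntryLetters_of_realSlice ℛ hholo (fun u hu i j => (hbd u hu i j).trans (le_max_right _ _)) hreal hB0
    (le_max_left _ _) hρ hr0 hr1

/-! ## §4. T-58.4 — the accretivity margin on the complex ball from REAL coercivity at the centre ([II] p.15's perturbative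
argument, tree `accretive_of_coercive_add` by name) -/

omit [NormedAddCommGroup E] [NormedSpace ℂ E] [DecidableEq p] in
/-- **T-58.4 — ACCRETIVITY ON A SET OF COMPLEX CONFIGURATIONS FROM A REAL COERCIVE REFERENCE**: if `T₀` (real; the operator at
the real reference background, `γ`-coercive: [B9] Thm 3.12-shape positivity) and the complex deviation `A(u) − T₀` has absolute
row and column sums `≤ p₀` for `u ∈ s`, then `A(u)` is `(γ − p₀)`-accretive on `s` — hypothesis (b) of T-58.3 with `m = γ − p₀`
([B9] Thm 3.4 p.400: «In fact we prove quantitative statements which are more precise, describing these analytic extensions as small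
perturbations of the operators depending on U only»).
[cite: Balaban1988RG2Cluster, p.15, (2.16) p.16; Balaban1985BackgroundPropagators, Thm 3.4 p.400, Thm 3.12 p.423] -/
theorem accretive_of_coercive_sub {A : E → Matrix p p ℂ} {s : Set E} {T₀ : Matrix p p ℝ} {γ p₀ : ℝ}
    (hc : QGQInverse.Coercive T₀ γ) (hp : 0 ≤ p₀)
    (hrow : ∀ u ∈ s, ∀ i, ∑ j, ‖A u i j - (T₀ i j : ℂ)‖ ≤ p₀)
    (hcol : ∀ u ∈ s, ∀ j, ∑ i, ‖A u i j - (T₀ i j : ℂ)‖ ≤ p₀) :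
    ∀ u ∈ s, ∀ v : p → ℂ, (γ - p₀) * ∑ i, ‖v i‖ ^ 2 ≤ (∑ i, star (v i) * (A u *ᵥ v) i).re := by
  intro u hu v
  have e : A u = T₀.map (algebraMap ℝ ℂ) + (A u - T₀.map (algebraMap ℝ ℂ)) := by abel
  rw [e]
  refine accretive_of_coercive_add hc hp (fun i => ?_) (fun j => ?_) v
  · simpa [Matrix.sub_apply, Matrix.map_apply] using hrow u hu i
  · simpa [Matrix.sub_apply, Matrix.map_apply] using hcol u hu j

/-! ## §5. T-58.5 — WHY THE REAL TYPING CANNOT CARRY THE `u`-DEPENDENCE (dag-n10-c census v5, typed): a holomorphic family of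
REAL matrices is constant -/

omit [Fintype p] [DecidableEq p] in
/-- **T-58.5 — a complex-differentiable function with REAL values on a ball is constant there** (open mapping theorem along the
complex line through `0` and `u`; `Mathlib`'s `AnalyticOnNhd.is_constant_or_isOpen`). [folklore] [cite: Balaban1985BackgroundPropagators, Thm 3.4 p.400] -/
theorem eq_of_realValued (f : E → ℂ) {R : ℝ} (hf : DifferentiableOn ℂ f (ball (0 : E) R))
    (hreal : ∀ u ∈ ball (0 : E) R, (f u).im = 0) : ∀ u ∈ ball (0 : E) R, f u = f 0 := by
  intro u hu
  by_cases hu0 : u = 0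
  · rw [hu0]
  have hnu : 0 < ‖u‖ := norm_pos_iff.2 hu0
  have huR : ‖u‖ < R := mem_ball_zero_iff.1 hu
  set ρ : ℝ := R / ‖u‖ with hρ
  have hρ1 : 1 < ρ := (one_lt_div hnu).2 huR
  have hρ0 : 0 < ρ := by linarith
  set γ : ℂ → E := fun z => z • u with hγdef
  have hγ : MapsTo γ (ball (0 : ℂ) ρ) (ball (0 : E) R) := by
    intro z hz
    rw [mem_ball_zero_iff] at hz ⊢
    calc ‖z • u‖ = ‖z‖ * ‖u‖ := norm_smul _ _
      _ < ρ * ‖u‖ := mul_lt_mul_of_pos_right hz hnu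
      _ = R := div_mul_cancel₀ R hnu.ne'
  have hg : DifferentiableOn ℂ (f ∘ γ) (ball (0 : ℂ) ρ) :=
    hf.comp (fun z _ => (differentiableAt_id.smul_const u).differentiableWithinAt) hγ
  have han : AnalyticOnNhd ℂ (f ∘ γ) (ball (0 : ℂ) ρ) := hg.analyticOnNhd isOpen_ball
  have h0mem : (0 : ℂ) ∈ ball (0 : ℂ) ρ := mem_ball_self hρ0
  have h1mem : (1 : ℂ) ∈ ball (0 : ℂ) ρ := by rw [mem_ball_zero_iff, norm_one]; exact hρ1
  rcases han.is_constant_or_isOpen (convex_ball (0 : ℂ) ρ).isPreconnected with ⟨w, hw⟩ | hopen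
  · have h1 := hw 1 h1mem
    have h0 := hw 0 h0mem
    simp only [Function.comp_apply, hγdef, one_smul, zero_smul] at h1 h0
    rw [h1, h0]
  · exfalso
    have hO := hopen (ball 0 ρ) Subset.rfl isOpen_ball
    have hmem : (f ∘ γ) 0 ∈ (f ∘ γ) '' ball (0 : ℂ) ρ := mem_image_of_mem _ h0mem
    obtain ⟨ε, hε, hball⟩ := Metric.isOpen_iff.1 hO _ hmem
    have hpt : (f ∘ γ) 0 + ((ε / 2 : ℝ) : ℂ) * Complex.I ∈ ball ((f ∘ γ) 0) ε := by
      rw [mem_ball, dist_eq_norm, add_sub_cancel_left, norm_mul, Complex.norm_real, Complex.norm_I, mul_one,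
        Real.norm_eq_abs, abs_of_pos (half_pos hε)]
      exact half_lt_self hε
    obtain ⟨z, hz, hzeq⟩ := hball hpt
    have him := congr_arg Complex.im hzeq
    have hz' : ((f ∘ γ) z).im = 0 := hreal _ (hγ hz)
    have h0' : ((f ∘ γ) 0).im = 0 := hreal _ (hγ h0mem)
    rw [hz', Complex.add_im, h0', Complex.mul_im, Complex.ofReal_re, Complex.ofReal_im, Complex.I_re, Complex.I_im] at him
    have : (0 : ℝ) = ε / 2 := by linarith
    linarith

omit [Fintype p] [DecidableEq p] in
/-- **T-58.5′ — A `u`-HOLOMORPHIC FAMILY OF REAL MATRICES IS `u`-CONSTANT** (dag-n10-c's census v5 «LOCATED (currency)» paragraph,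
kernel-checked): if every `Δ₀(u)`, `‖u‖ < R`, is a real matrix read as complex and the entries are complex-differentiable on the
ball, then `Δ₀(u) = Δ₀(0)` on the ball.  Hence module 32's `hEL` with genuine `u`-dependence can NOT be fed by a family typed
through N06's real `Ops310` at every complex `u`; T-58.1′ ∕ T-58.3 is the typing that can (real operators on the real slice only).
[cite: Balaban1985BackgroundPropagators, Thm 3.4 p.400; Balaban1988RG2Cluster, p.15] -/
theorem eq_of_realOps {Δ₀ : E → Matrix p p ℂ} {R : ℝ}
    (hholo : ∀ i j, DifferentiableOn ℂ (fun u => Δ₀ u i j) (ball (0 : E) R))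
    (hreal : ∀ u ∈ ball (0 : E) R, ∃ G : Matrix p p ℝ, Δ₀ u = G.map (algebraMap ℝ ℂ)) :
    ∀ u ∈ ball (0 : E) R, Δ₀ u = Δ₀ 0 := by
  intro u hu
  ext i j
  refine eq_of_realValued (fun u => Δ₀ u i j) (hholo i j) (fun w hw => ?_) u hu
  obtain ⟨G, hG⟩ := hreal w hw
  simp [hG, Matrix.map_apply]

/-! ## §6. NON-VACUITY WITH GENUINE `u`-DEPENDENCE: a toy inhabitant of T-58.3's three hypotheses in the chart `E = ℂ` -/

/-- TOY MODEL (not Bałaban's operator): the scalar precision family `A(u) = (γ + u)·1` on `p` sites, `γ > 0`, over the chart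
`E = ℂ` with its real axis as real slice. [folklore] [cite: Balaban1988RG2Cluster, (2.7) p.13 (toy model, not the paper's operator)] -/
def toyFamily (γ : ℝ) (u : ℂ) : Matrix p p ℂ := ((γ : ℂ) + u) • (1 : Matrix p p ℂ)

omit [Fintype p] in
/-- The toy family is genuinely `u`-dependent: its diagonal moves with `u`. [folklore] [cite: Balaban1988RG2Cluster, (2.7) p.13 (toy model)] -/
theorem toyFamily_diag_sub (γ : ℝ) (u : ℂ) (i : p) : toyFamily γ u i i - toyFamily γ 0 i i = u := by
  simp [toyFamily]

omit [Fintype p] in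
/-- (a) entrywise holomorphy of the toy family (everywhere). [folklore] [cite: Balaban1988RG2Cluster, (2.7) p.13 (toy model)] -/
theorem toy_holo (γ : ℝ) (s : Set ℂ) (i j : p) : DifferentiableOn ℂ (fun u => toyFamily γ u i j) s := by
  show DifferentiableOn ℂ (fun u => (((γ : ℂ) + u) • (1 : Matrix p p ℂ)) i j) s
  simp only [Matrix.smul_apply, smul_eq_mul]
  exact ((differentiableOn_const _).add differentiableOn_id).mul (differentiableOn_const _)

/-- (b) the toy family is `γ∕2`-accretive on the complex ball `‖u‖ < γ∕2`. [folklore] [cite: Balaban1988RG2Cluster, (2.7) p.13 (toy model)] -/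
theorem toy_accretive {γ : ℝ} :
    ∀ u ∈ ball (0 : ℂ) (γ / 2), ∀ v : p → ℂ,
      γ / 2 * ∑ i, ‖v i‖ ^ 2 ≤ (∑ i, star (v i) * (toyFamily γ u *ᵥ v) i).re := by
  intro u hu v
  have hterm : ∀ i, star (v i) * (((γ : ℂ) + u) * v i) = ((γ : ℂ) + u) * ((‖v i‖ : ℂ) ^ 2) := by
    intro i
    rw [mul_left_comm, Complex.star_def, Complex.conj_mul']
  have hsum : (∑ i, star (v i) * (toyFamily γ u *ᵥ v) i) = ((γ : ℂ) + u) * ∑ i, ((‖v i‖ : ℂ) ^ 2) := by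
    simp only [toyFamily, Matrix.smul_mulVec, Matrix.one_mulVec, Pi.smul_apply, smul_eq_mul, hterm,
      Finset.mul_sum]
  rw [hsum]
  have hc : (∑ i, ((‖v i‖ : ℂ) ^ 2)) = ((∑ i, ‖v i‖ ^ 2 : ℝ) : ℂ) := by push_cast; rfl
  rw [hc, Complex.re_mul_ofReal]
  have hre : γ / 2 ≤ ((γ : ℂ) + u).re := by
    rw [Complex.add_re, Complex.ofReal_re]
    have h1 := neg_le_of_abs_le (Complex.abs_re_le_norm u)
    have h2 : ‖u‖ < γ / 2 := mem_ball_zero_iff.1 hu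
    linarith
  exact mul_le_mul_of_nonneg_right hre (Finset.sum_nonneg fun i _ => by positivity)

/-- The toy family's scalar is bounded below on the ball: `‖γ + v‖ ≥ γ∕2` for `‖v‖ < γ∕2`. [folklore] [cite: Balaban1988RG2Cluster, (2.7) p.13 (toy model)] -/
theorem toy_scalar_ge {γ : ℝ} (hγ : 0 < γ) {v : ℂ} (hv : ‖v‖ < γ / 2) : γ / 2 ≤ ‖(γ : ℂ) + v‖ := by
  have h := norm_sub_le ((γ : ℂ) + v) v
  rw [add_sub_cancel_right, Complex.norm_real, Real.norm_eq_abs, abs_of_pos hγ] at h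
  linarith

/-- The inverse of the toy family in closed form. [folklore] [cite: Balaban1988RG2Cluster, (2.7) p.13 (toy model)] -/
theorem toy_inv {γ : ℝ} (hγ : 0 < γ) {v : ℂ} (hv : ‖v‖ < γ / 2) :
    (toyFamily (p := p) γ v)⁻¹ = ((γ : ℂ) + v)⁻¹ • (1 : Matrix p p ℂ) := by
  have hne : (γ : ℂ) + v ≠ 0 := fun h => by
    have := toy_scalar_ge hγ hv
    rw [h, norm_zero] at this
    linarith
  refine Matrix.inv_eq_left_inv ?_
  rw [toyFamily, Matrix.smul_mul, Matrix.one_mul, smul_smul, inv_mul_cancel₀ hne, one_smul]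

/-- (c) real-slice (indeed everywhere-on-the-ball) decay of the toy inverse: diagonal `≤ 2∕γ`, off-diagonal zero. [folklore] [cite: Balaban1988RG2Cluster, (2.7) p.13 (toy model)] -/
theorem toy_realSlice {γ : ℝ} (hγ : 0 < γ) (loc : p → UT Nf) {ρ : ℝ} :
    ∀ v ∈ realStructureComplex.Ereal, ‖v‖ < γ / 2 → ∀ i j,
      ‖(toyFamily (p := p) γ v)⁻¹ i j‖ ≤ 2 / γ * Real.exp (-(ρ * tdist1 Nf (loc i) (loc j))) := by
  intro v _ hv i j
  rw [toy_inv hγ hv, Matrix.smul_apply, smul_eq_mul, norm_mul, norm_inv]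
  by_cases hij : i = j
  · subst hij
    rw [Matrix.one_apply_eq, norm_one, mul_one, tdist1_self, mul_zero, neg_zero, Real.exp_zero, mul_one]
    exact (inv_anti₀ (half_pos hγ) (toy_scalar_ge hγ hv)).trans_eq (by rw [inv_div])
  · rw [Matrix.one_apply_ne hij, norm_zero, mul_zero]
    exact mul_nonneg (div_nonneg (by norm_num) hγ.le) (Real.exp_nonneg _)

/-- **T-58.3 FIRES ON A `u`-DEPENDENT FAMILY**: the toy covariance `u ↦ ((γ + u)·1)⁻¹` is a `RawEntryLetters` datum on the
shrunken complex ball, obtained from (a) holomorphy + (b) accretivity of the UN-inverted family on the complex ball and (c) decay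
of the inverse ON THE REAL AXIS ONLY — no decay estimate at complex `u` was supplied. [cite: Ransford1995, Thm. 4.3.7] -/
theorem rawEntryLetters_toy {γ : ℝ} (hγ : 0 < γ) (loc : p → UT Nf) {ρ r : ℝ} (hρ : 0 ≤ ρ) (hr0 : 0 < r)
    (hr1 : r < 1) :
    RawEntryLetters (fun u => (toyFamily (p := p) γ u)⁻¹) loc (r / (1 + r) * (γ / 2)) ((1 - lam r) * ρ)
      ((2 / γ) ^ (1 - lam r) * (max (2 / γ) (2 / (γ / 2))) ^ lam r) :=
  rawEntryLetters_inv_of_realSlice realStructureComplex (half_pos hγ) (fun i j => toy_holo γ _ i j) toy_accretive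
    (toy_realSlice hγ loc) (div_nonneg (by norm_num) hγ.le) hρ hr0 hr1

end Literature.MathematicalPhysics.QuantumFieldTheory.Balaban1983to89.B13RealSliceEntryLetters

end
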